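import Mathlib
import Literature.LinearAlgebra.Matrix.PermanentSubperm
import Summits.ValiantsHypothesis.ValiantsHypothesis.Theorems.ValuativeGCTValuativeFlipCyclicContinuant
import Summits.ValiantsHypothesis.ValiantsHypothesis.Theorems.ValuativeGCTValuativeFlipCyclicTridiagonalCofactorSum

/-!
# The cofactor formula `F = T + S` of a cyclic tridiagonal matrix (crux `ValuativeGCT.ValuativeFlip`,
# stub `stub_fourRowPencilRank`, part P1 of the cyclic-tridiagonal architecture — bridge to the
# registered currency)

Helper file (`--supports stmt-ValiantsHypothesis-12624`).  The registered stub
`subperm_ne_ne_eq_Tw_add_Sw` (k9 gen1 a2) asks, for the cyclic tridiagonal matrix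
`A r r = l r`, `A r (r+1) = m r`, `A r (r-1) = m' r` on `ZMod n` (`n = e + k + 1 ≥ 3`, `1 ≤ e`):

  `A.subperm (· ≠ q) (· ≠ q + e) = Tw l m m' q e + Sw l m m' (q + e) (k + 1)`

(delete column `q` and row `q + e`; `Tw`, `Sw`, `kont`, `cstr` of `…CyclicContinuant`).  This file
proves it for EVERY matrix `A` with that entry pattern (`ct_subperm_ne_ne_eq_Tw_add_Sw`; k9g1a2's
own proof for `cycM` landed in parallel as `…CyclicCofactor.subperm_ne_ne_eq_Tw_add_Sw`, which is the
instance `A = cycM l m m'`, `hA := fun _ _ => rfl`, of the theorem here), by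
enumerating the kept rows `q+e+1, q+e+2, …` and columns `q+1, q+2, …` (the subpermanent becomes the
permanent of the unrolled matrix `ctU`, `…CyclicTridiagonalUnrolled`) and translating the closed
form `ct_permanent_ctU` (`kont = ctK` on shifted data, `kont_eq_ctK`).
-/

set_option linter.dupNamespace false

namespace Summit.ValiantsHypothesis.ValiantsHypothesis.Theorems.ValuativeFlip

open scoped BigOperators Matrix
open Finset

variable {R : Type*} [CommRing R] {n : ℕ}

/-- The `ZMod`-indexed continuant of `…CyclicContinuant` is the `ℕ`-indexed continuant `ctK` of the
shifted data. [this crux] -/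
theorem kont_eq_ctK (l m m' : ZMod n → R) (a : ZMod n) :
    ∀ L : ℕ, kont l m m' a L =
      ctK (fun t => l (a + (t : ZMod n))) (fun t => m (a + (t : ZMod n))) (fun t => m' (a + (t : ZMod n))) L := by
  intro L
  induction L using Nat.strong_induction_on with
  | _ L ih =>
    rcases L with _ | _ | L
    · rfl
    · simp
    · rw [kont_add_two, ctK_add_two, ih (L + 1) (by omega), ih L (by omega)]

/-- Casting lemma: for `u < n` and `v < 2n`, `(u : ZMod n) = v ↔ u = v ∨ u + n = v`. [folklore] -/
theorem ct_natCast_eq_iff {u v : ℕ} (hu : u < n) (hv : v < 2 * n) :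
    ((u : ZMod n) = (v : ZMod n)) ↔ (u = v ∨ u + n = v) := by
  rw [ZMod.natCast_eq_natCast_iff', Nat.mod_eq_of_lt hu]
  by_cases h : v < n
  · rw [Nat.mod_eq_of_lt h]
    omega
  · rw [Nat.mod_eq_sub_mod (by omega), Nat.mod_eq_of_lt (by omega)]
    omega

section Main

variable [NeZero n] (l m m' : ZMod n → R)

/-- **`F = T + S` for every matrix with the cyclic tridiagonal entry pattern** (the registered stub
`subperm_ne_ne_eq_Tw_add_Sw` is the instance `A = cycM l m m'`): deleting column `q` and row
`q + e` (`n = e + k + 1 ≥ 3`, `1 ≤ e`) leaves the subpermanent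
`Tw l m m' q e + Sw l m m' (q + e) (k + 1)`: the clockwise string `m_q ⋯ m_{q+e-1}` times the
continuant of the arc `q+e+1, …, q-1`, plus the counter-clockwise string `cstr m' (q+e+1) (k+1)`
times the continuant of the arc `q+1, …, q+e-1`
(`Cruxes/ValuativeFlip/AxisK9G1a2CyclicTridiagonal.md` §2). [this crux] -/
theorem ct_subperm_ne_ne_eq_Tw_add_Sw (hn3 : 3 ≤ n) (A : Matrix (ZMod n) (ZMod n) R)
    (hA : ∀ r s, A r s =
      if s = r then l r else if s = r + 1 then m r else if s = r - 1 then m' r else 0)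
    (q : ZMod n) {e k : ℕ} (hn : n = e + k + 1) (he : 1 ≤ e) :
    A.subperm (fun c => c ≠ q) (fun r => r ≠ q + (e : ZMod n)) =
      Tw l m m' q e + Sw l m m' (q + (e : ZMod n)) (k + 1) := by
  obtain ⟨k₂, hk₂⟩ : ∃ k₂, e + k = k₂ + 2 := ⟨e + k - 2, by omega⟩
  have hnself : ((n : ℕ) : ZMod n) = 0 := ZMod.natCast_self n
  -- enumerations of the kept rows and columns
  have hne : ∀ a : Fin (k₂ + 2), (q : ZMod n) + (e : ZMod n) + 1 + ((a : ℕ) : ZMod n) ≠ q + (e : ZMod n) := by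
    intro a h
    have h1 : (((a : ℕ) + 1 : ℕ) : ZMod n) = 0 := by
      push_cast
      linear_combination h
    rw [ZMod.natCast_eq_zero_iff] at h1
    have := Nat.le_of_dvd (by omega) h1
    have := a.isLt
    omega
  have hne' : ∀ b : Fin (k₂ + 2), (q : ZMod n) + 1 + ((b : ℕ) : ZMod n) ≠ q := by
    intro b h
    have h1 : (((b : ℕ) + 1 : ℕ) : ZMod n) = 0 := by
      push_cast
      linear_combination h
    rw [ZMod.natCast_eq_zero_iff] at h1
    have := Nat.le_of_dvd (by omega) h1
    have := b.isLt
    omega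
  let fr : Fin (k₂ + 2) → {r : ZMod n // r ≠ q + (e : ZMod n)} :=
    fun a => ⟨q + (e : ZMod n) + 1 + ((a : ℕ) : ZMod n), hne a⟩
  let fc : Fin (k₂ + 2) → {c : ZMod n // c ≠ q} := fun b => ⟨q + 1 + ((b : ℕ) : ZMod n), hne' b⟩
  have hinj : ∀ a b : Fin (k₂ + 2), (((a : ℕ) : ZMod n) = ((b : ℕ) : ZMod n)) → a = b := by
    intro a b h
    rw [ct_natCast_eq_iff (by omega) (by omega)] at h
    exact Fin.ext (by omega)
  have hfr : Function.Bijective fr := by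
    rw [Fintype.bijective_iff_injective_and_card]
    refine ⟨fun a b h => hinj a b ?_, ?_⟩
    · have := congrArg Subtype.val h
      simp only [fr] at this
      linear_combination this
    · rw [Fintype.card_fin, Fintype.card_subtype_compl, Fintype.card_subtype_eq, ZMod.card]
      omega
  have hfc : Function.Bijective fc := by
    rw [Fintype.bijective_iff_injective_and_card]
    refine ⟨fun a b h => hinj a b ?_, ?_⟩
    · have := congrArg Subtype.val h
      simp only [fc] at this
      linear_combination this
    · rw [Fintype.card_fin, Fintype.card_subtype_compl, Fintype.card_subtype_eq, ZMod.card]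
      omega
  rw [Matrix.subperm_eq_permanent_of_equiv A (Equiv.ofBijective fc hfc) (Equiv.ofBijective fr hfr)]
  -- the enumerated minor is the unrolled matrix
  have hmat : (Matrix.of fun a b : Fin (k₂ + 2) =>
      A ((Equiv.ofBijective fr hfr a : {r : ZMod n // r ≠ q + (e : ZMod n)}) : ZMod n)
        ((Equiv.ofBijective fc hfc b : {c : ZMod n // c ≠ q}) : ZMod n)) =
      ctU (fun t => l (q + (e : ZMod n) + 1 + (t : ZMod n))) (fun t => m (q + (e : ZMod n) + 1 + (t : ZMod n)))
        (fun t => m' (q + (e : ZMod n) + 1 + (t : ZMod n))) (k₂ + 2) e := by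
    ext a b
    simp only [Matrix.of_apply, Equiv.ofBijective_apply, fr, fc]
    have ha : (a : ℕ) < k₂ + 2 := a.isLt
    have hb : (b : ℕ) < k₂ + 2 := b.isLt
    -- the three congruences as conditions on naturals
    have cast0 : (q + 1 + ((b : ℕ) : ZMod n) = q + (e : ZMod n) + 1 + ((a : ℕ) : ZMod n)) ↔
        (((b : ℕ) : ZMod n) = ((a + e : ℕ) : ZMod n)) := by
      constructor
      · intro h
        push_cast
        linear_combination h
      · intro h
        push_cast at h
        linear_combination h
    have cast1 : (q + 1 + ((b : ℕ) : ZMod n) = q + (e : ZMod n) + 1 + ((a : ℕ) : ZMod n) + 1) ↔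
        (((b : ℕ) : ZMod n) = ((a + e + 1 : ℕ) : ZMod n)) := by
      constructor
      · intro h
        push_cast
        linear_combination h
      · intro h
        push_cast at h
        linear_combination h
    have cast2 : (q + 1 + ((b : ℕ) : ZMod n) = q + (e : ZMod n) + 1 + ((a : ℕ) : ZMod n) - 1) ↔
        (((b + 1 : ℕ) : ZMod n) = ((a + e : ℕ) : ZMod n)) := by
      constructor
      · intro h
        push_cast
        linear_combination h
      · intro h
        push_cast at h
        linear_combination h
    have key0 : (q + 1 + ((b : ℕ) : ZMod n) = q + (e : ZMod n) + 1 + ((a : ℕ) : ZMod n)) ↔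
        ((b : ℕ) = a + e ∨ (b : ℕ) + (k₂ + 2 + 1) = a + e) := by
      rw [cast0, ct_natCast_eq_iff (n := n) (by omega) (by omega)]
      constructor <;> intro h <;> omega
    have key1 : (q + 1 + ((b : ℕ) : ZMod n) = q + (e : ZMod n) + 1 + ((a : ℕ) : ZMod n) + 1) ↔
        ((b : ℕ) = a + e + 1 ∨ (b : ℕ) + (k₂ + 2 + 1) = a + e + 1) := by
      rw [cast1, ct_natCast_eq_iff (n := n) (by omega) (by omega)]
      constructor <;> intro h <;> omega
    have key2 : (q + 1 + ((b : ℕ) : ZMod n) = q + (e : ZMod n) + 1 + ((a : ℕ) : ZMod n) - 1) ↔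
        ((b : ℕ) + 1 = a + e ∨ (b : ℕ) + (k₂ + 2 + 1) + 1 = a + e) := by
      rw [cast2, ct_natCast_eq_iff (n := n) (by omega) (by omega)]
      constructor <;> intro h <;> omega
    rw [hA]
    by_cases h0 : (b : ℕ) = a + e ∨ (b : ℕ) + (k₂ + 2 + 1) = a + e
    · rw [if_pos (key0.mpr h0), ctU_apply_L _ _ _ _ _ h0]
    rw [if_neg (fun h => h0 (key0.mp h))]
    by_cases h1 : (b : ℕ) = a + e + 1 ∨ (b : ℕ) + (k₂ + 2 + 1) = a + e + 1
    · rw [if_pos (key1.mpr h1), ctU_apply_M _ _ _ _ _ h0 h1]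
    rw [if_neg (fun h => h1 (key1.mp h))]
    by_cases h2 : (b : ℕ) + 1 = a + e ∨ (b : ℕ) + (k₂ + 2 + 1) + 1 = a + e
    · rw [if_pos (key2.mpr h2), ctU_apply_M' _ _ _ _ _ h0 h1 h2]
    rw [if_neg (fun h => h2 (key2.mp h)), ctU_apply_zero _ _ _ _ _ h0 h1 h2]
  rw [hmat, ct_permanent_ctU _ _ _ k₂ e he (by omega)]
  -- translate the closed form
  have hk : k₂ + 2 - e = k := by omega
  have hk' : k₂ + 3 - e = k + 1 := by omega
  have hne1 : n - 1 - e = k := by omega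
  have hne2 : n - 1 - (k + 1) = e - 1 := by omega
  simp only [Tw, Sw, cstr, kont_eq_ctK, hk, hk', hne1, hne2]
  have hwrap : (q : ZMod n) + (e : ZMod n) + 1 + (k : ZMod n) = q := by
    have : ((e + k + 1 : ℕ) : ZMod n) = 0 := by rw [← hn]; exact hnself
    push_cast at this
    linear_combination this
  congr 1
  · congr 1
    · refine Finset.prod_congr rfl fun a _ => ?_
      push_cast
      congr 1
      linear_combination hwrap
    · refine ctK_congr _ (fun t _ => ?_) (fun t _ => ?_) (fun t _ _ => ?_) <;>
        · push_cast
          congr 1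
          ring
  · congr 1
    refine ctK_congr _ (fun t _ => ?_) (fun t _ => ?_) (fun t _ _ => ?_) <;>
      · push_cast
        congr 1
        ring

end Main

end Summit.ValiantsHypothesis.ValiantsHypothesis.Theorems.ValuativeFlip
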